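import Literature.NumberTheory.ComplexMultiplication.CMTypeRankMultiplicityOne
import HarnessLib

/-!
# Self-conjugate stabiliser orbits: the EXACT orbit form of multiplicity one of the odd weights

COR-CM (cell `pub-hodgecm2`, binder seat `b16` gen 54, count-neutral claim STAB-CONJ, file F1 — abstract `G`-set level;
theorems only, no definition, no named fact, no `sorry`).  NEW as stated, hence under `Summits/`.  HONEST FRAMING:
finite-dimensional linear algebra about the Kubota–Dodson rank of CM types on an abstract `G`-set; `HC_CM` is neither used
nor asserted.

SETTING.  `G` acts on a finite set `X` (for CM fields: `G = Aut(ℂ)`, `X = Hom(K, ℂ)`), `ρ ∈ G` a central fixed-point-free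
involution on `X` (complex conjugation), `Anti = {f : f(ρx) = −f(x)}` the odd weights, `U(Φ) = antiSpan G Φ ≤ Anti` the
span of the `±1`-vectors of the translates of a CM type `Φ` (`rank Φ = dim U(Φ) + 1`).  The tree's MULTIPLICITY-ONE
hypothesis (M1) of `Literature/…/CMTypeRankMultiplicityOne` — every `G`-equivariant `T : ℚ^X → ℚ^X` with `ρ`-odd values
is a scalar multiple of `f ↦ f − f∘ρ` — makes every CM type nondegenerate and decides same-slot families by linear
independence of the type vectors; it was supplied so far from PAIR FLIPS (`CorCM/GenericCMFieldTypes`, seat p2) and from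
DOUBLE FLIPS (`CorCM/DoubleFlipCMFieldsHodge`, this seat gen 46).  This file gives its EXACT combinatorial form:

> **(SC) — self-conjugate stabiliser orbits.**  For every base point `x₀` and every `x ∉ {x₀, ρx₀}` some `g ∈ G` FIXES
> `x₀` and CONJUGATES `x`: `g x₀ = x₀`, `g x = ρx`.  Equivalently: every orbit of the point stabiliser `Stab(x₀)` on
> `X ∖ {x₀, ρx₀}` is `ρ`-stable.

* §1 `stabConj_of_stabConj_at` — under transitivity (SC) at ONE base point gives (SC) at every base point.
* §2 **`exists_smul_sub_of_stabConj`: (SC) ⟹ (M1)** — for an equivariant odd `T`, `T δ_{x₀}` is `Stab(x₀)`-invariant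
  and odd, hence vanishes at every `x ∉ {x₀, ρx₀}` (`f(x) = f(gx) = f(ρx) = −f(x)`), so `T δ_{x₀} = c (δ_{x₀} − δ_{ρx₀})`
  and transitivity propagates the constant.
* §3 **`stabConj_of_multiplicityOne`: (M1) ⟹ (SC)** (no transitivity needed) — if no element of `Stab(x₀)` conjugates
  `x`, the ORBITAL KERNEL `R(y, z) = [∃ g, g x₀ = y ∧ g x = z]` defines the equivariant odd operator
  `(T f)(z) = Σ_y f(y) (R(y, z) − R(y, ρz))` with `(T δ_{x₀})(x) = 1`, while `c (δ_{x₀}(x) − δ_{x₀}(ρx)) = 0`.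
  So (M1) ⟺ (SC): the commutant of `G` on `Anti` is `ℚ` exactly when the stabiliser orbits off the base pair are
  self-conjugate (the odd half of «the rank of a transitive permutation group is the number of suborbits»).
* §4 consequences of (SC) for a CM type `Φ` (via the Literature (M1) theorems): **`antiSpan_eq_antiWeights_of_stabConj`**
  (`U(Φ) = Anti`), **`typeRank_eq_of_stabConj`** (EVERY CM type is nondegenerate, `rank = |X|/2 + 1`),
  **`antiWeights_irreducible_of_stabConj`** / `antiSpan_irreducible_of_stabConj` (`Anti` is an IRREDUCIBLE `G`-module —
  the `hirr` hypothesis of this seat's Goursat / coefficient / orbit criteria, gens 51–53), and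
  **`typeRank_sigmaType_eq_iff_linearIndependent_of_stabConj`** (a same-slot family is nondegenerate ⟺ its type vectors
  are linearly independent).
* §5 `stabConj_of_pairFlip`, `stabConj_of_doubleFlip` — pair flips, and double flips with at least three pairs, are
  instances of (SC); (SC) is strictly weaker (it only asks for ONE element per pair `(x₀, x)`, arbitrary elsewhere).

For a CM field `K` and `x₀, x : K → ℂ`, (SC) at `(x₀, x)` reads: `x` and `x̄` are conjugate over the field `x₀(K)`, i.e.
`x(K) ⊄ x₀(K)·x(K⁺)` — the same-field case of this seat's pointwise partial conjugation test (gen 48); see F2.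

## References

* [Serre1977] J.-P. Serre, *Linear Representations of Finite Groups*, GTM 42, §1.3 Thm. 1, §2.2 Prop. 4 (Schur), §7.2.
* [Wielandt1964] H. Wielandt, *Finite Permutation Groups*, Academic Press (1964), §28–§29 (the centralizer ring of a
  transitive group: its dimension is the number of orbits of a point stabiliser, Thm. 28.4; self-paired suborbits §16).
* [Kubota1965] T. Kubota, *On the field extension by complex multiplication*, Trans. AMS 118 (1965), §2 Lemma 2.
* [Mai1989] L. Mai, *Lower bounds for the ranks of CM types*, J. Number Theory 32 (1989), §2 Prop. 1 (proof).
* [Dodson1984] B. Dodson, *The structure of Galois groups of CM-fields*, Trans. AMS 283 (1984), §1.1, §5.1.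
-/

set_option autoImplicit false

noncomputable section

open scoped BigOperators

universe u v w

namespace Summit.HodgeConjecture.CorCM.StabConj

open Literature.NumberTheory.ComplexMultiplication
open scoped Classical

variable {G : Type u} [Group G] {X : Type v} [MulAction G X]

/-! ### §1 One base point suffices -/

/-- **(SC) at one base point gives (SC) everywhere** (transitive action, `ρ` central): conjugate the witness by an
element carrying `x₀` to `x₁`. [cite: Wielandt1964, §16 and Thm. 28.4] -/
theorem stabConj_of_stabConj_at [MulAction.IsPretransitive G X] {ρ : G}
    (hc : ∀ (g : G) (x : X), g • ρ • x = ρ • g • x) {x₀ : X}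
    (hSC : ∀ x : X, x ≠ x₀ → x ≠ ρ • x₀ → ∃ g : G, g • x₀ = x₀ ∧ g • x = ρ • x)
    (x₁ x : X) (hx : x ≠ x₁) (hx' : x ≠ ρ • x₁) : ∃ g : G, g • x₁ = x₁ ∧ g • x = ρ • x := by
  obtain ⟨k, hk⟩ := MulAction.exists_smul_eq G x₀ x₁
  have h1 : k⁻¹ • x ≠ x₀ := by
    intro h
    apply hx
    calc x = k • k⁻¹ • x := (smul_inv_smul k x).symm
      _ = x₁ := by rw [h, hk]
  have h2 : k⁻¹ • x ≠ ρ • x₀ := by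
    intro h
    apply hx'
    calc x = k • k⁻¹ • x := (smul_inv_smul k x).symm
      _ = ρ • x₁ := by rw [h, hc, hk]
  obtain ⟨g, hg₀, hgx⟩ := hSC (k⁻¹ • x) h1 h2
  refine ⟨k * g * k⁻¹, ?_, ?_⟩
  · rw [mul_smul, mul_smul, ← hk, inv_smul_smul, hg₀]
  · rw [mul_smul, mul_smul, hgx, hc, smul_inv_smul]

/-! ### §2 (SC) ⟹ (M1) -/

section SCtoM1

variable [Fintype X]

omit [Fintype X] in
/-- The translate of a point mass: `x ↦ δ_s(g⁻¹x)` is `δ_{g s}`. [folklore] -/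
theorem ite_eq_inv_smul (g : G) (s : X) (c : ℚ) :
    (fun x : X => if s = g⁻¹ • x then c else 0) = fun x => if g • s = x then c else 0 := by
  funext x
  rw [eq_inv_smul_iff]

/-- **(SC) ⟹ (M1): self-conjugate stabiliser orbits force multiplicity one of the odd weights.**  If `ρ ∈ G` is a
fixed-point-free involution on the transitive `G`-set `X` and for all `x₀` and `x ∉ {x₀, ρx₀}` some `g ∈ Stab(x₀)` has
`g x = ρ x`, then every `G`-equivariant linear `T : ℚ^X → ℚ^X` with `ρ`-odd values is a scalar multiple of `f ↦ f − f∘ρ`.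
[cite: Wielandt1964, Thm. 28.4] [cite: Serre1977, §2.2 Prop. 4] -/
theorem exists_smul_sub_of_stabConj [MulAction.IsPretransitive G X] {ρ : G}
    (hi : ∀ x : X, ρ • ρ • x = x) (hρ : ∀ x : X, ρ • x ≠ x)
    (hSC : ∀ x₀ x : X, x ≠ x₀ → x ≠ ρ • x₀ → ∃ g : G, g • x₀ = x₀ ∧ g • x = ρ • x)
    (T : (X → ℚ) →ₗ[ℚ] (X → ℚ))
    (hT : ∀ (g : G) (f : X → ℚ), T (fun x => f (g⁻¹ • x)) = fun x => T f (g⁻¹ • x))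
    (hodd : ∀ (f : X → ℚ) (x : X), T f (ρ • x) = -T f x) :
    ∃ c : ℚ, ∀ f, T f = c • fun x => f x - f (ρ • x) := by
  -- point masses and their translates
  let δ : X → X → ℚ := fun s x => if s = x then 1 else 0
  have hδg : ∀ (g : G) (s : X), (fun x => δ s (g⁻¹ • x)) = δ (g • s) := fun g s => ite_eq_inv_smul g s 1
  -- `T δ_s` vanishes off `{s, ρ s}`: a stabiliser element conjugating `t` gives `(T δ_s)(t) = (T δ_s)(ρ t)`
  have hoff : ∀ s t : X, t ≠ s → t ≠ ρ • s → T (δ s) t = 0 := by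
    intro s t hts htc
    obtain ⟨g, hgs, hgt⟩ := hSC s t hts htc
    have h1 := hT g (δ s)
    rw [hδg, hgs] at h1
    have h2 := congrFun h1 (g • t)
    simp only [inv_smul_smul] at h2
    rw [hgt, hodd] at h2
    linarith
  -- hence `T δ_s = (T δ_s)(s) · (δ_s − δ_{ρ s})`
  have hsne : ∀ s : X, s ≠ ρ • s := fun s h => hρ s h.symm
  have hshape : ∀ s x : X, T (δ s) x = T (δ s) s * (δ s x - δ s (ρ • x)) := by
    intro s x
    by_cases hxs : x = s
    · subst hxs
      simp only [δ, if_pos rfl, if_neg (hsne x)]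
      ring
    · by_cases hxc : x = ρ • s
      · subst hxc
        rw [hodd, hi]
        simp only [δ, if_pos rfl, if_neg (hsne s)]
        ring
      · have hsx : s ≠ ρ • x := fun h => hxc (by rw [h, hi])
        rw [hoff s x hxs hxc]
        simp only [δ, if_neg (Ne.symm hxs), if_neg hsx]
        ring
  -- the scalar `(T δ_s)(s)` does not depend on `s`
  rcases isEmpty_or_nonempty X with hX | ⟨⟨s₀⟩⟩
  · exact ⟨0, fun f => funext fun x => (IsEmpty.false x).elim⟩
  have hconst : ∀ s : X, T (δ s) s = T (δ s₀) s₀ := by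
    intro s
    obtain ⟨g, hg⟩ := MulAction.exists_smul_eq G s₀ s
    have h1 := hT g (δ s₀)
    rw [hδg, hg] at h1
    rw [congrFun h1 s, ← hg, inv_smul_smul]
  refine ⟨T (δ s₀) s₀, fun f => ?_⟩
  have hf : f = ∑ s, f s • δ s := by
    convert pi_eq_sum_univ f using 1
  have hsum1 : ∀ y : X, ∑ s, f s * δ s y = f y := fun y => by
    simp only [δ, mul_ite, mul_one, mul_zero, Finset.sum_ite_eq', Finset.mem_univ, if_true]
  conv_lhs => rw [hf]
  rw [map_sum]
  funext x
  simp only [map_smul, Finset.sum_apply, Pi.smul_apply, smul_eq_mul]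
  rw [Finset.sum_congr rfl fun s _ => show f s * T (δ s) x = T (δ s₀) s₀ * (f s * δ s x - f s * δ s (ρ • x)) by
      rw [hshape s x, hconst s]; ring,
    ← Finset.mul_sum, Finset.sum_sub_distrib, hsum1, hsum1]

end SCtoM1

/-! ### §3 (M1) ⟹ (SC) -/

section M1toSC

variable [Fintype X]

/-- **(M1) ⟹ (SC): multiplicity one of the odd weights forces self-conjugate stabiliser orbits.**  If no element of
`Stab(x₀)` carries `x ∉ {x₀, ρx₀}` to `ρx`, the orbital kernel `R(y,z) = [∃ g, g x₀ = y ∧ g x = z]` yields the equivariant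
odd operator `(T f)(z) = Σ_y f(y)(R(y,z) − R(y,ρz))` with `(T δ_{x₀})(x) = 1 ≠ 0 = c(δ_{x₀}(x) − δ_{x₀}(ρx))`.
(`ρ` central and involutive; no transitivity needed.) [cite: Wielandt1964, Thm. 28.4] [cite: Serre1977, §2.2 Prop. 4] -/
theorem stabConj_of_multiplicityOne {ρ : G}
    (hc : ∀ (g : G) (x : X), g • ρ • x = ρ • g • x) (hi : ∀ x : X, ρ • ρ • x = x)
    (hM1 : ∀ T : (X → ℚ) →ₗ[ℚ] (X → ℚ),
      (∀ (g : G) (f : X → ℚ), T (fun x => f (g⁻¹ • x)) = fun x => T f (g⁻¹ • x)) →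
      (∀ (f : X → ℚ) (x : X), T f (ρ • x) = -T f x) → ∃ c : ℚ, ∀ f, T f = c • fun x => f x - f (ρ • x))
    (x₀ x : X) (hx : x ≠ x₀) (hx' : x ≠ ρ • x₀) : ∃ g : G, g • x₀ = x₀ ∧ g • x = ρ • x := by
  by_contra hno
  -- the orbital kernel of `(x₀, x)`
  let R : X → X → ℚ := fun y z => if ∃ g : G, g • x₀ = y ∧ g • x = z then 1 else 0
  have hR : ∀ (k : G) (y z : X), R (k • y) z = R y (k⁻¹ • z) := by
    intro k y z
    have hiff : (∃ g : G, g • x₀ = k • y ∧ g • x = z) ↔ ∃ g : G, g • x₀ = y ∧ g • x = k⁻¹ • z := by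
      constructor
      · rintro ⟨g, hg₀, hgx⟩
        exact ⟨k⁻¹ * g, by rw [mul_smul, hg₀, inv_smul_smul], by rw [mul_smul, hgx]⟩
      · rintro ⟨g, hg₀, hgx⟩
        exact ⟨k * g, by rw [mul_smul, hg₀], by rw [mul_smul, hgx, smul_inv_smul]⟩
    by_cases hP : ∃ g : G, g • x₀ = k • y ∧ g • x = z
    · simp only [R, if_pos hP, if_pos (hiff.1 hP)]
    · simp only [R, if_neg hP, if_neg (mt hiff.2 hP)]
  let T : (X → ℚ) →ₗ[ℚ] (X → ℚ) :=
    { toFun := fun f z => ∑ y, f y * (R y z - R y (ρ • z))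
      map_add' := fun f f' => by
        funext z
        simp only [Pi.add_apply, add_mul, Finset.sum_add_distrib]
      map_smul' := fun c f => by
        funext z
        simp only [Pi.smul_apply, smul_eq_mul, RingHom.id_apply, Finset.mul_sum, mul_assoc] }
  have hTapp : ∀ (f : X → ℚ) (z : X), T f z = ∑ y, f y * (R y z - R y (ρ • z)) := fun f z => rfl
  have hTeq : ∀ (k : G) (f : X → ℚ), T (fun y => f (k⁻¹ • y)) = fun z => T f (k⁻¹ • z) := by
    intro k f
    funext z
    rw [hTapp, hTapp]
    rw [← Equiv.sum_comp (MulAction.toPerm k) (fun y => f (k⁻¹ • y) * (R y z - R y (ρ • z)))]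
    refine Finset.sum_congr rfl fun y _ => ?_
    simp only [MulAction.toPerm_apply, inv_smul_smul]
    rw [hR k y z, hR k y (ρ • z), hc]
  have hTodd : ∀ (f : X → ℚ) (z : X), T f (ρ • z) = -T f z := by
    intro f z
    rw [hTapp, hTapp, ← Finset.sum_neg_distrib]
    refine Finset.sum_congr rfl fun y _ => ?_
    rw [hi]
    ring
  obtain ⟨c, hcT⟩ := hM1 T hTeq hTodd
  -- evaluate `T δ_{x₀}` at `x`
  let δ₀ : X → ℚ := fun y => if y = x₀ then 1 else 0
  have h1 : T δ₀ x = 1 := by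
    rw [hTapp]
    simp only [δ₀, ite_mul, one_mul, zero_mul, Finset.sum_ite_eq', Finset.mem_univ, if_true]
    have hRx : R x₀ x = 1 := by
      simp only [R, if_pos (⟨1, one_smul G x₀, one_smul G x⟩ : ∃ g : G, g • x₀ = x₀ ∧ g • x = x)]
    have hRρ : R x₀ (ρ • x) = 0 := by
      simp only [R, if_neg hno]
    rw [hRx, hRρ, sub_zero]
  have h2 : T δ₀ x = 0 := by
    rw [hcT δ₀]
    have hρx : ρ • x ≠ x₀ := fun h => hx' (by rw [← h, hi])
    simp only [Pi.smul_apply, smul_eq_mul, δ₀, if_neg hx, if_neg hρx, sub_zero, mul_zero]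
  rw [h2] at h1
  exact zero_ne_one h1

end M1toSC

/-! ### §4 Consequences of (SC) for CM types -/

section Consequences

variable [Fintype X] [Nonempty X]

/-- **`U(Φ) = Anti` for every CM type of an (SC) slot**: the translates of `u_1(Φ)` span all odd weights.
[cite: Kubota1965, §2 Lemma 2] [cite: Mai1989, §2 Prop. 1 (proof)] -/
theorem antiSpan_eq_antiWeights_of_stabConj [MulAction.IsPretransitive G X] {ρ : G} {Φ : Set X}
    (h : IsCMTypeWith ρ Φ) (hSC : ∀ x₀ x : X, x ≠ x₀ → x ≠ ρ • x₀ → ∃ g : G, g • x₀ = x₀ ∧ g • x = ρ • x) :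
    antiSpan G Φ = antiWeights (E := X) ρ :=
  antiSpan_eq_antiWeights_of_multiplicityOne h
    (exists_smul_sub_of_stabConj h.invol h.rho_smul_ne hSC)

/-- **Every CM type of an (SC) slot is nondegenerate**: `rank(Φ) = |X|/2 + 1` (on abelian varieties: `dim MT(A_Φ) =
dim A_Φ + 1`, `B• = D•` on all powers). [cite: Kubota1965, §2 Lemma 2] [cite: Mai1989, §2 Prop. 1 (proof)] -/
theorem typeRank_eq_of_stabConj [MulAction.IsPretransitive G X] {ρ : G} {Φ : Set X} (h : IsCMTypeWith ρ Φ)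
    (hSC : ∀ x₀ x : X, x ≠ x₀ → x ≠ ρ • x₀ → ∃ g : G, g • x₀ = x₀ ∧ g • x = ρ • x) :
    typeRank G Φ = Fintype.card X / 2 + 1 :=
  typeRank_eq_of_multiplicityOne h (exists_smul_sub_of_stabConj h.invol h.rho_smul_ne hSC)

omit [Nonempty X] in
/-- **`Anti` is an irreducible `G`-module under (SC)**: every non-zero `G`-stable subspace of the odd weights is all of
them (`ρ` a fixed-point-free involution). [cite: Serre1977, §1.3 Thm. 1 and §2.2 Prop. 4] -/
theorem antiWeights_irreducible_of_stabConj [MulAction.IsPretransitive G X] {ρ : G}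
    (hi : ∀ x : X, ρ • ρ • x = x) (hρ : ∀ x : X, ρ • x ≠ x)
    (hSC : ∀ x₀ x : X, x ≠ x₀ → x ≠ ρ • x₀ → ∃ g : G, g • x₀ = x₀ ∧ g • x = ρ • x)
    (W : Submodule ℚ (X → ℚ)) (hW : W ≤ antiWeights (E := X) ρ) (hW0 : W ≠ ⊥)
    (hst : ∀ (k : G) (f : X → ℚ), f ∈ W → (fun y => f (k • y)) ∈ W) : W = antiWeights (E := X) ρ := by
  let A : Submodule ℚ (X → ℚ) := antiWeights ρ
  have hmemA : ∀ f : X → ℚ, f ∈ A ↔ ∀ x, f (ρ • x) = -f x := fun f => Iff.rfl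
  let P : (X → ℚ) →ₗ[ℚ] (X → ℚ) := (1 / 2 : ℚ) • (LinearMap.id - LinearMap.funLeft ℚ ℚ fun x : X => ρ • x)
  have hP : ∀ f x, P f x = (1 / 2 : ℚ) * (f x - f (ρ • x)) := fun f x => rfl
  have hPid : ∀ a ∈ A, P a = a := fun a ha => by
    funext x
    rw [hP, (hmemA a).1 ha x]
    ring
  have hM1 := exists_smul_sub_of_stabConj hi hρ hSC
  have hM1' : ∀ T : (X → ℚ) →ₗ[ℚ] (X → ℚ),
      (∀ (g : G) (f : X → ℚ), T (fun x => f (g⁻¹ • x)) = fun x => T f (g⁻¹ • x)) →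
      (∀ f, T f ∈ A) → ∃ c : ℚ, ∀ f, T f = c • P f := fun T hT hTA => by
    obtain ⟨c, hcT⟩ := hM1 T hT fun f => (hmemA _).1 (hTA f)
    refine ⟨2 * c, fun f => ?_⟩
    rw [hcT f]
    funext x
    simp only [Pi.smul_apply, hP, smul_eq_mul]
    ring
  exact (eq_bot_or_eq_of_multiplicityOne (G := G) P hPid hM1' hW fun k f hf => hst k f hf).resolve_left hW0

/-- **`U(Φ)` is irreducible for every CM type of an (SC) slot** — the `hirr` hypothesis of the Goursat dichotomy
(`CorCM/PairFlipTransportDichotomy`), of the coefficient criterion (`CorCM/PairFlipSlotCoefficientCriterion`) and of the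
orbit criterion (`CorCM/StabiliserOrbitKernel`). [cite: Serre1977, §1.3 Thm. 1 and §2.2 Prop. 4] -/
theorem antiSpan_irreducible_of_stabConj [MulAction.IsPretransitive G X] {ρ : G} {Φ : Set X} (h : IsCMTypeWith ρ Φ)
    (hSC : ∀ x₀ x : X, x ≠ x₀ → x ≠ ρ • x₀ → ∃ g : G, g • x₀ = x₀ ∧ g • x = ρ • x)
    (W : Submodule ℚ (X → ℚ)) (hW : W ≤ antiSpan G Φ) (hW0 : W ≠ ⊥)
    (hst : ∀ (k : G) (f : X → ℚ), f ∈ W → (fun y => f (k • y)) ∈ W) : W = antiSpan G Φ := by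
  rw [antiSpan_eq_antiWeights_of_stabConj h hSC] at hW ⊢
  exact antiWeights_irreducible_of_stabConj h.invol h.rho_smul_ne hSC W hW hW0 hst

/-- **Same-slot families under (SC): nondegenerate ⟺ the type vectors are linearly independent** (`Hg(∏ A_{Φ_i}) =
∏ Hg(A_{Φ_i})` for CM types `Φ_i` of ONE (SC) field iff the `u_1(Φ_i) ∈ ℚ^X` are independent).
[cite: Mai1989, §2 Prop. 1 (proof)] [cite: Kubota1965, §2 Lemma 2] -/
theorem typeRank_sigmaType_eq_iff_linearIndependent_of_stabConj {I : Type w} [Fintype I] [DecidableEq I] [Nonempty I]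
    [MulAction.IsPretransitive G X] {ρ : G} (Φ : I → Set X) (h : ∀ i, IsCMTypeWith ρ (Φ i))
    (hSC : ∀ x₀ x : X, x ≠ x₀ → x ≠ ρ • x₀ → ∃ g : G, g • x₀ = x₀ ∧ g • x = ρ • x) :
    typeRank G (sigmaType (E := fun _ : I => X) Φ) = Fintype.card (Σ _ : I, X) / 2 + 1 ↔
      LinearIndependent ℚ fun i => antiVec (Φ i) (1 : G) :=
  have h₀ := h (Classical.arbitrary I)
  typeRank_sigmaType_eq_iff_linearIndependent_of_multiplicityOne Φ h
    (exists_smul_sub_of_stabConj h₀.invol h₀.rho_smul_ne hSC)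

end Consequences

/-! ### §5 Pair flips and double flips are instances of (SC) -/

section Instances

/-- **Pair flips ⟹ (SC)**: the flip at `x` fixes `x₀ ∉ {x, ρx}`. [cite: Dodson1984, §1.1] -/
theorem stabConj_of_pairFlip {ρ : G} (hi : ∀ x : X, ρ • ρ • x = x)
    (hflip : ∀ x : X, ∃ φ : G, φ • x = ρ • x ∧ ∀ x' : X, x' ≠ x → x' ≠ ρ • x → φ • x' = x')
    (x₀ x : X) (hx : x ≠ x₀) (hx' : x ≠ ρ • x₀) : ∃ g : G, g • x₀ = x₀ ∧ g • x = ρ • x := by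
  obtain ⟨φ, hφx, hφ⟩ := hflip x
  have hρx : x₀ ≠ ρ • x := fun h => hx' (by rw [h, hi])
  exact ⟨φ, hφ x₀ (Ne.symm hx) hρx, hφx⟩

/-- **Double flips with at least three pairs ⟹ (SC)**: the double flip at `x` and at a point `t` of a third pair fixes
`x₀`. [cite: Dodson1984, §1.1 and §5.1] -/
theorem stabConj_of_doubleFlip [Fintype X] {ρ : G} (hi : ∀ x : X, ρ • ρ • x = x) (h6 : 6 ≤ Fintype.card X)
    (hflip : ∀ x t : X, t ≠ x → t ≠ ρ • x → ∃ φ : G, φ • x = ρ • x ∧ φ • t = ρ • t ∧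
      ∀ y : X, y ≠ x → y ≠ ρ • x → y ≠ t → y ≠ ρ • t → φ • y = y)
    (x₀ x : X) (hx : x ≠ x₀) (hx' : x ≠ ρ • x₀) : ∃ g : G, g • x₀ = x₀ ∧ g • x = ρ • x := by
  -- a point `t` outside the two pairs of `x₀` and `x`
  have hcard : ({x₀, ρ • x₀, x, ρ • x} : Finset X).card < (Finset.univ : Finset X).card := by
    rw [Finset.card_univ]
    refine lt_of_le_of_lt ?_ (lt_of_lt_of_le (by norm_num : 4 < 6) h6)
    refine (Finset.card_insert_le _ _).trans ?_
    refine (Nat.succ_le_succ (Finset.card_insert_le _ _)).trans ?_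
    refine (Nat.succ_le_succ (Nat.succ_le_succ (Finset.card_insert_le _ _))).trans ?_
    rw [Finset.card_singleton]
  obtain ⟨t, -, ht⟩ := Finset.exists_mem_notMem_of_card_lt_card hcard
  simp only [Finset.mem_insert, Finset.mem_singleton, not_or] at ht
  obtain ⟨ht₀, htρ₀, htx, htρx⟩ := ht
  obtain ⟨φ, hφx, -, hφ⟩ := hflip x t htx htρx
  have h0ρx : x₀ ≠ ρ • x := fun h => hx' (by rw [h, hi])
  have h0ρt : x₀ ≠ ρ • t := fun h => htρ₀ (by rw [h, hi])
  exact ⟨φ, hφ x₀ (Ne.symm hx) h0ρx (Ne.symm ht₀) h0ρt, hφx⟩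

end Instances

end Summit.HodgeConjecture.CorCM.StabConj

end
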